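import Literature.Barriers.ValiantsHypothesis.BIJL18PermanentZeroDivisibilityProofs
import Literature.Barriers.ValiantsHypothesis.CKRST20EquationsFromHittingSets
import Literature.Computability.AlgebraicComplexity.ArithCircuitProofs
import Literature.Computability.AlgebraicComplexity.ValiantConjectureEquivProofs
import Summits.ValiantsHypothesis.ValiantsHypothesis.Statement
import HarnessLib

/-!
# Permanental PIT ≡ Valiant's hypothesis (record theorem; decomp-valiant workshop, lens 2, g17)

Natural-proofs axis, RECORD ROW V28 («permanental PIT»). The unconditional equations for the
bounded-coefficient slices of `VP` (Chatterjee–Kumar–Ramya–Saptharishi–Tengse 2020, Thm. 1.4) are built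
from hitting sets (`CKRST2020.exists_equation_intBox`, Thm. 4.3): their NON-ROOTS are exactly the
nonzero bounded polynomials vanishing on the hitting set `ℋ` (`ckrst_equation_nonroot_iff`). Hence such an equation
certifies `per_n ∉ 𝒞` iff `ℋ ⊆ Z(per_n)`, and the question "does a CKRST-type natural proof separate
the permanent from `VP(s)`?" is the question "is the permanental hypersurface `Z(per_n)` a hitting
set for the degree-`≤ n` slice of `VP(s)`?" (`PerZeroHits n s`).

* `exists_eq_C_mul_perPoly` — a polynomial of total degree `≤ n` vanishing on `Z(per_n) ⊆ ℂ^{n×n}`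
  is a scalar multiple of `per_n` (BIJL18 step 4 `perPoly_dvd_of_forall_permanent_eq_zero` +
  `totalDegree_perPoly` + `totalDegree_mul_of_isDomain`).
* `perZeroHits_iff` — `Z(per_n)` hits every nonzero `g` with `deg g ≤ n`, `L(g) ≤ s` iff no nonzero
  scalar multiple of `per_n` has complexity `≤ s`.
* `valiantsHypothesis_iff_perZeroHits` — `ValiantsHypothesis ↔ ∀ c, ∃ n, PerZeroHits n (n ^ c + c)`;
  `not_perZeroHits_of_collapse` — the certificate reading under `VP = VNP`.

Verdict for the decomposition record: the piece is an EQUIV of the summit (COSTUME as a piece; no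
node is built on it). It is filed as negative knowledge: CKRST-type natural proofs certify
permanent hardness exactly when their hitting set lies on `Z(per)`, and the existence of such
hitting sets for `VP(n^c)_{≤ n}` for every `c` is `VP ≠ VNP` itself.

References: Chatterjee–Kumar–Ramya–Saptharishi–Tengse 2020 (arXiv:2004.14147) Thm. 1.4/4.3;
Bläser–Ikenmeyer–Jindal–Lysikov 2018 (ECCC TR17-009 / STOC'18) §6 step 4, Thm. 6;
von zur Gathen 1987 Thm. 3.4 (irreducibility of `per`); Bürgisser 2000 Def. 2.1–2.2, Rem. 2.11.
-/

set_option linter.dupNamespace false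

noncomputable section

namespace Summit.ValiantsHypothesis.ValiantsHypothesis.Theorems.PermanentalPIT

open MvPolynomial Literature.Computability.AlgebraicComplexity
open Literature.Barriers.ValiantsHypothesis

/-! ### Soundness of hitting-set certificates (the trivial direction) -/

/-- If `W ⊆ Z(f)` and `W` hits every member of `𝒞`, then `f ∉ 𝒞`. [folklore] -/
theorem not_mem_of_hits_of_subset_zeroLocus {σ k : Type*} [CommSemiring k]
    {f : MvPolynomial σ k} {W : Set (σ → k)} {𝒞 : Set (MvPolynomial σ k)}
    (hW : ∀ a ∈ W, eval a f = 0) (hhit : ∀ g ∈ 𝒞, ∃ a ∈ W, eval a g ≠ 0) : f ∉ 𝒞 := by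
  intro hf
  obtain ⟨a, ha, hne⟩ := hhit f hf
  exact hne (hW a ha)

/-- **Reading of CKRST 2020 Thm. 4.3** (`CKRST2020.exists_equation_intBox`): the equation `P_ℋ` built
from a hitting set `ℋ` does NOT vanish at `coeff(f)` (for `f` of degree `≤ d` with integer
coefficients bounded by `A`) iff `f ≠ 0` and `f` vanishes identically on `ℋ`, i.e. iff `ℋ ⊆ Z(f)`.
[cite: ChatterjeeKumarRamyaSaptharishiTengse2020, Thm. 4.3] -/
theorem ckrst_equation_nonroot_iff (K : Type*) [Field K] [CharZero K] (n d A B : ℕ) (hB1 : 1 ≤ B)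
    (H : Finset (Fin n → ℤ)) (hH : ∀ a ∈ H, ∀ j, |a j| ≤ B) :
    ∃ P : MvPolynomial (monomialsDegLE n d) K, P ≠ 0 ∧
      ∀ f : MvPolynomial (Fin n) K, f.totalDegree ≤ d →
        (∀ m, ∃ z : ℤ, coeff m f = (z : K) ∧ |z| ≤ A) →
        (eval (coeffVector (monomialsDegLE n d) f) P ≠ 0 ↔
          (f ≠ 0 ∧ ∀ a ∈ H, eval (fun j => ((a j : ℤ) : K)) f = 0)) := by
  obtain ⟨P, hP0, -, -, hP⟩ := CKRST2020.exists_equation_intBox K n d A B hB1 H hH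
  refine ⟨P, hP0, fun f hd hc => ?_⟩
  rw [Ne, hP f hd hc]
  push Not
  rfl

/-! ### The permanental hypersurface hits everything of degree `≤ n` except `ℂ · per_n` -/

/-- A polynomial vanishing on `Z(per_n) ⊆ ℂ^{n × n}` is divisible by `per_n` (BIJL18 §6 step 4,
`perPoly_dvd_of_forall_permanent_eq_zero`, in point form).
[cite: BlaserIkenmeyerJindalLysikov2018, §6 (proof of Thm. 5, step 4)] -/
theorem perPoly_dvd_of_vanish {n : ℕ} (g : MvPolynomial (Fin n × Fin n) ℂ)
    (hg : ∀ a : Fin n × Fin n → ℂ, eval a (perPoly (Fin n) ℂ) = 0 → eval a g = 0) :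
    perPoly (Fin n) ℂ ∣ g := by
  refine PerZeroDivisibility.perPoly_dvd_of_forall_permanent_eq_zero g fun A hA => hg _ ?_
  rw [eval_perPoly]
  have hM : (Matrix.of fun i j : Fin n => (fun v : Fin n × Fin n => A v.1 v.2) (i, j)) = A := by
    ext i j
    rfl
  rw [hM]
  exact hA

/-- **K3.** A polynomial of total degree `≤ n` vanishing on `Z(per_n)` is a scalar multiple of
`per_n` (divisibility by the degree-`n` polynomial `per_n` plus additivity of total degree over a
domain). [cite: Vonzurgathen1987, Thm. 3.4] -/
theorem exists_eq_C_mul_perPoly {n : ℕ} (g : MvPolynomial (Fin n × Fin n) ℂ)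
    (hdeg : g.totalDegree ≤ n)
    (hg : ∀ a : Fin n × Fin n → ℂ, eval a (perPoly (Fin n) ℂ) = 0 → eval a g = 0) :
    ∃ c : ℂ, g = C c * perPoly (Fin n) ℂ := by
  obtain ⟨h, rfl⟩ := perPoly_dvd_of_vanish g hg
  by_cases hh : h = 0
  · exact ⟨0, by simp [hh]⟩
  have hper : (perPoly (Fin n) ℂ).totalDegree = n := by
    simpa [Fintype.card_fin] using totalDegree_perPoly_holds (n := Fin n) (k := ℂ)
  have hmul := totalDegree_mul_of_isDomain (perPoly_ne_zero (Fin n) ℂ) hh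
  have h0 : h.totalDegree = 0 := by omega
  rw [totalDegree_eq_zero_iff_eq_C] at h0
  refine ⟨coeff 0 h, ?_⟩
  rw [mul_comm]
  exact congrArg (· * perPoly (Fin n) ℂ) h0

/-- `PerZeroHits n s`: the permanental hypersurface `Z(per_n) ⊆ ℂ^{n×n}` is a hitting set for the
slice `{g ≠ 0 : deg g ≤ n, L(g) ≤ s}` — every such `g` has a non-zero on `Z(per_n)`. [folklore] -/
def PerZeroHits (n s : ℕ) : Prop :=
  ∀ g : MvPolynomial (Fin n × Fin n) ℂ, g ≠ 0 → g.totalDegree ≤ n → complexity g ≤ s →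
    ∃ a : Fin n × Fin n → ℂ, eval a (perPoly (Fin n) ℂ) = 0 ∧ eval a g ≠ 0

/-- **`Z(per_n)` hits the size-`s` degree-`≤ n` slice iff no nonzero scalar multiple of `per_n` has
complexity `≤ s`.** [folklore] -/
theorem perZeroHits_iff (n s : ℕ) :
    PerZeroHits n s ↔ ∀ c : ℂ, c ≠ 0 → s < complexity (C c * perPoly (Fin n) ℂ) := by
  constructor
  · intro h c hc
    by_contra hle
    push Not at hle
    have hne : C c * perPoly (Fin n) ℂ ≠ 0 :=
      mul_ne_zero (by simpa using hc) (perPoly_ne_zero _ _)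
    have hdeg : (C c * perPoly (Fin n) ℂ).totalDegree ≤ n := by
      refine (totalDegree_mul _ _).trans ?_
      rw [totalDegree_C, zero_add]
      have hper : (perPoly (Fin n) ℂ).totalDegree = n := by
        simpa [Fintype.card_fin] using totalDegree_perPoly_holds (n := Fin n) (k := ℂ)
      exact hper.le
    obtain ⟨a, ha, hga⟩ := h _ hne hdeg hle
    exact hga (by rw [map_mul, ha, mul_zero])
  · intro h g hg0 hdeg hs
    by_contra hno
    push Not at hno
    obtain ⟨c, rfl⟩ := exists_eq_C_mul_perPoly g hdeg hno
    have hc : c ≠ 0 := by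
      rintro rfl
      exact hg0 (by simp)
    exact absurd hs (not_le.mpr (h c hc))

/-- One scalar gate: `L(per_n) ≤ L(c · per_n) + 1` for `c ≠ 0` (`complexity_smul_le_holds`).
[cite: Burgisser2000, §2.1] -/
theorem complexity_perPoly_le_succ (n : ℕ) {c : ℂ} (hc : c ≠ 0) :
    complexity (perPoly (Fin n) ℂ) ≤ complexity (C c * perPoly (Fin n) ℂ) + 1 := by
  have h := complexity_smul_le_holds (σ := Fin n × Fin n) c⁻¹ (C c * perPoly (Fin n) ℂ)
  rwa [smul_eq_C_mul, ← mul_assoc, ← C_mul, inv_mul_cancel₀ hc, C_1, one_mul] at h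

/-- **Permanental PIT ≡ Valiant's hypothesis.** `VP_ℂ ≠ VNP_ℂ` iff for every exponent `c` some
permanental hypersurface `Z(per_n)` is a hitting set for the degree-`≤ n` slice of `VP(n ^ c + c)`
(through `perNotPComputableComplex_iff_holds`, von zur Gathen 1987 Prop. 4.8 / Bürgisser 2000
Rem. 2.11, and one scalar gate). The right-hand side is the `V = Z(per_n)` member of the family
«a permanental variety `V` hits the slice»; its Kabanets–Impagliazzo member (`V` = closure of the image
of a planted-permanent generator) is lens-5's crux `DefinabilityGap.KIPlantedHitting`, necessary for
VH; at `V = Z(per_n)` the family is the summit itself. [cite: Vonzurgathen1987Feasible, Prop. 4.8] -/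
theorem valiantsHypothesis_iff_perZeroHits :
    _root_.ValiantsHypothesis ↔ ∀ c : ℕ, ∃ n : ℕ, PerZeroHits n (n ^ c + c) := by
  show VP ℂ ≠ VNP ℂ ↔ _
  rw [← perNotPComputableComplex_iff_holds]
  unfold IsPComputable IsPBounded
  constructor
  · intro hV c
    push Not at hV
    obtain ⟨n, hn⟩ := hV (c + 2)
    refine ⟨n, (perZeroHits_iff n _).2 fun a ha => ?_⟩
    have h2 := complexity_perPoly_le_succ n ha
    have h3 : n ^ c ≤ n ^ (c + 2) + 1 := by
      rcases Nat.eq_zero_or_pos n with rfl | hn0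
      · rcases Nat.eq_zero_or_pos c with rfl | hc0
        · simp
        · rw [Nat.zero_pow hc0]
          exact Nat.zero_le _
      · exact (Nat.pow_le_pow_right hn0 (by omega)).trans (Nat.le_succ _)
    omega
  · rintro hP ⟨c, hc⟩
    obtain ⟨n, hn⟩ := hP c
    have h1 := (perZeroHits_iff n _).1 hn 1 one_ne_zero
    rw [C_1, one_mul] at h1
    exact absurd (hc n) (not_le.mpr h1)

/-- Contrapositive reading for certificates: if `VP_ℂ = VNP_ℂ` then from some exponent on NO
permanental hypersurface `Z(per_n)` is a hitting set for `VP(n ^ c + c)_{≤ n}` — so no CKRST-type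
equation built from a hitting set of such a slice can have `per_n` as a non-root. [folklore] -/
theorem not_perZeroHits_of_collapse (h : VP ℂ = VNP ℂ) :
    ∃ c : ℕ, ∀ n : ℕ, ¬ PerZeroHits n (n ^ c + c) := by
  by_contra hne
  push Not at hne
  exact (valiantsHypothesis_iff_perZeroHits.2 hne) h

end Summit.ValiantsHypothesis.ValiantsHypothesis.Theorems.PermanentalPIT

end
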